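import Mathlib
import HarnessLib
import HarnessLib.Audit
import Summits.AtomisticToContinuum.Statement
import Literature.MathematicalPhysics.QuantumManyBody.PeriodicBoseGas
import Literature.Analysis.UnboundedOperators.HeatKernel
import Summits.AtomisticToContinuum.BoseEinsteinCondensation.Theorems.BECFisherTransferPeriodicOccupationStability
import HarnessLib.Audit.Status.Attr

/-!
Route: BECRieszShadow

# Route BECRieszShadow — BEC via the Riesz-exponent ladder — positive-type Jastrow shadows condense
iff s > 0 (provable now); the true gas needs only a bounded teleportation entropy of its many-body
remainder

It suffices to show X = PalmAffinityBound (card riesz-shadow-harmonic-extension, its Palm–Jensen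
assembly in the needle-robust
existential form, on the TORUS): for every repulsive finite-range v, all small ρ, some C and all
large N = n+1, for EVERY δ > 0 there
is a NONNEGATIVE δ-near-minimiser Ψ of the periodic energy (L = (N/ρ)^(1/3)) whose Palm affinity is
uniformly bounded below,
∫Ψ(x,Y)² dY ≤ e^C ∫Ψ(x,Y)Ψ(y,Y) dY for all x, y (uniform-in-separation ODLRO of a positive
near-ground state; γ(x,y) ≥ e^(−C)ρ).
With the frame cruxes PeriodicRigidity (near-minimisers are L²-close up to a phase) and
BoundaryTransferWeak (shared with
BECPeriodicReduction, stmt-0827) this gives the conjunct. Below X the line is the Riesz-exponent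
ladder: the classical shadow
|Ψ|² of a positive-type Jastrow state has teleportation entropy KL(P_x‖P_y) ≤ u(0) − u(x−y) (support
PositiveTypeJastrowKL,
provable now), so smeared Riesz-s Jastrow states condense for every coupling iff s > 0
(RieszJastrowCondensate), and for the true
gas only the many-body remainder of −log Ψ₀² is at stake (cruxes TeleportEntropyBound,
PhononDressing); hard cores (KL = +∞) are the residual crux HardCorePalmAffinity (= X on the
unbounded class, shared with BECLiebAntibunching), and the support glue AffinityOfEntropy :
TeleportEntropyBound → HardCorePalmAffinity → X (the support PalmJensen entering as a lemma) wires
the cruxes to X (route-choice repair 2026-08-16, revs 7–13).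
Lean: `∀ v : ℝ → ENNReal,
Literature.MathematicalPhysics.QuantumManyBody.BoseGas.IsRepulsiveFiniteRange v → ∃ ρ₀ : ℝ, 0 < ρ₀ ∧
∀ ρ : ℝ, 0 < ρ → ρ < ρ₀ → ∃ C : ℝ, ∀ᶠ n : ℕ in Filter.atTop, ∀ δ : ENNReal, 0 < δ → ∃ Ψ :
Literature.MathematicalPhysics.QuantumManyBody.BoseGas.PeriodicTrialState (n + 1)
(Literature.MathematicalPhysics.QuantumManyBody.BoseGas.sideLength ρ (n + 1)),
Literature.MathematicalPhysics.QuantumManyBody.BoseGas.periodicEnergy v Ψ ≤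
Literature.MathematicalPhysics.QuantumManyBody.BoseGas.periodicGroundStateEnergy v (n + 1)
(Literature.MathematicalPhysics.QuantumManyBody.BoseGas.sideLength ρ (n + 1)) + δ ∧ (∀ X, Ψ.ψ X =
(‖Ψ.ψ X‖ : ℂ)) ∧ ∀ x y : Literature.MathematicalPhysics.QuantumManyBody.BoseGas.Space, ∫⁻ Y in
Literature.MathematicalPhysics.QuantumManyBody.BoseGas.cellN n
(Literature.MathematicalPhysics.QuantumManyBody.BoseGas.sideLength ρ (n + 1)), (‖Ψ.ψ (Matrix.vecCons
x Y)‖₊ : ENNReal) ^ 2 ≤ ENNReal.ofReal (Real.exp C) * ∫⁻ Y in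
Literature.MathematicalPhysics.QuantumManyBody.BoseGas.cellN n
(Literature.MathematicalPhysics.QuantumManyBody.BoseGas.sideLength ρ (n + 1)), (‖Ψ.ψ (Matrix.vecCons
x Y)‖₊ : ENNReal) * (‖Ψ.ψ (Matrix.vecCons y Y)‖₊ : ENNReal)`

## Assembly
The deciding theorem `closes : PalmAffinityBound → PeriodicRigidity → PalmAffinityFlatMode →
PeriodicOccupationStability → AffinityFrameGlue → BoundaryTransferWeak → BoseEinsteinCondensation`
is pure logic (glue.lean, elaborates sorry-free): AffinityFrameGlue turns the first four hypotheses
into the PeriodicBEC body for v and BoundaryTransferWeak v hv reads off HasGroundStateBEC, i.e. the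
conjunct `BoseEinsteinCondensation` (root abbrev of the Literature statement). The content of
AffinityFrameGlue is bookkeeping plus the two support inequalities (no new analysis): fix v; take ρ₀
= min of the ρ₀'s of PalmAffinityBound, PeriodicRigidity
and (inside BoundaryTransferWeak) nothing more; for ρ < ρ₀ get C from PalmAffinityBound and put c :=
e^(−C)/4; eventually in N = n+1 (both
filters; n+1 → ∞) apply PeriodicRigidity with η := e^(−C)/4 to get δ; PalmAffinityBound at this δ
gives Ψ ≥ 0 with the affinity bound,
so PalmAffinityFlatMode gives condensateOccupation(Ψ) ≥ e^(−C)N; for any δ-near-minimiser Φ rigidity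
gives ∫|Ψ − cΦ|² ≤ η and
PeriodicOccupationStability gives condensateOccupation(Φ)^(1/2) ≥ (e^(−C)N)^(1/2) − (N
e^(−C)/4)^(1/2) = (e^(−C)N)^(1/2)/2, i.e.
condensateOccupation(Φ) ≥ e^(−C)N/4 = cN: this is the PeriodicBEC body (stmt-0826) for v; feed it to
BoundaryTransferWeak v hv and read
off HasGroundStateBEC v ρ for ρ < ρ₀', i.e. the conjunct BoseEinsteinCondensation (=
Literature.MathematicalPhysics.QuantumManyBody.BoseGas.BoseEinsteinCondensation
by Iff.rfl). ENNReal bookkeeping only. (This route re-opens the retired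
route-AtomisticToContinuum-BECRieszLadder, closed `not-a-thesis` at
2026-08-15T13:40Z because its Assembly named the Literature constant instead of the sub-problem decl
and no `closes` was supplied; items are
identical plus AffinityFrameGlue.)

Rationale: WHY THIS LINE. Positivity of Ψ₀ makes γ(x,y)/ρ the Hellinger affinity of the Palm laws P_x, P_y of
the other N−1 bosons, and Jensen bounds it by
exp(−½KL(P_x‖P_y)) (Reatto1969, McMillan1965, PenroseOnsager1956; frame shared in spirit with route
BECPalmLandscape, which is
Dirichlet and uses a Debye–Mayer engine). New here (found while planning, elementary): for a Born
measure e^(−Σ_(i<j)u) on the torus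
with u even, continuous and conditionally positive-definite, KL(P_x‖P_y) = L⁻³Σ_(k≠0)
û(k)(1−S(k))(1−cos k·r) ≤ u(0) − u(r), because
S(k) ≥ 0 and û ≥ 0 — no screening theory at all; hence every positive-type Jastrow state with finite
self-energy has
n₀/N ≥ exp(−sup_r(u(0)−u(r))/2) uniformly in N and in the coupling, and the card's classification
"Jastrow–Riesz shadows condense
iff s > 0" is the statement that the smeared self-energy g_η(0) = K_s∫_(η²)^∞
t^((1−s)/2)(Θ_L(t,0)−L⁻³)dt is L-independent iff s > 0
(s = 0: ∼ log(L/η), the Tonks/Laughlin log-gas endpoints Lenard1964, GirvinMacdonald1987). Imported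
areas: point processes / Palm
laws and relative entropy (probability), positive-definite functions and heat-kernel subordination
of Riesz kernels (harmonic
analysis; CaffarelliSilvestre2007 for the s = d−1 extension picture), Coulomb/Riesz-gas statistical
mechanics (Lewin2022, Serfaty2024,
PeilenSerfaty2025 — now needed only if fluctuation, not mean, versions are wanted). What it does
that prior routes do not: it makes
the card's rungs R1 (Bijl–Dingle–Jastrow / OCP, s = 1) and R2 (phonon class, s = 2) provable-now
support theorems (first TL-BEC
theorems for correlated translation-invariant 3-D Bose wave functions in the tree), and reduces the
quantum problem to ONE quantity:
the Palm-mean tagged-particle increment of the many-body remainder of −log Ψ₀² after its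
positive-type long-range pair part is
split off (the pair part is free). Negatives index: empty (2026-08-15).

RANKED CRUXES. #0 PalmAffinityBound (target) — X as in § Thesis: for every admissible v, ρ < ρ₀(v),
some C, eventually in N = n+1, for every δ > 0 a nonnegative periodic δ-near-minimiser Ψ with
∫_(cell^n)|Ψ(x,Y)|² dY ≤ e^C ∫_(cell^n)|Ψ(x,Y)||Ψ(y,Y)| dY for all x, y ∈ ℝ³ (card item: Palm–Jensen
assembly; the true gas at η = ξ predicts C ≈ (4/√π)√(ρa³)). (why it might fail:
uniform-in-separation ODLRO with e^(−C) needs 2n₀/N − 1 > 0-type control at all r ≤ L√3/2; an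
unscreened marginal (three-body/backflow) tail of −log Ψ₀ would leave only γ ≥ ρN^(−ε); hard cores
enter through the affinity (fine) but forbid the KL currency below.) [Reatto1969,
PenroseOnsager1956, LSSY2005, ReattoChester1967, PeilenSerfaty2025]
#2 TeleportEntropyBound (crux) — TELEPORTATION ENTROPY OF THE TRUE GAS (card R3 in Palm-mean form;
bounded potentials). For every admissible v that is bounded (v ≤ M < ∞), ρ < ρ₀(v), some C,
eventually in N = n+1, for every δ > 0 there is a strictly positive periodic δ-near-minimiser Ψ (the
ground state itself qualifies) with x-independent slice mass ∫|Ψ(x,Y)|²dY and ∫|Ψ(x,Y)|²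
log(|Ψ(x,Y)|²/|Ψ(y,Y)|²) dY ≤ C ∫|Ψ(x,Y)|² dY for all x, y, i.e. KL(P_x‖P_y) ≤ C: the bath cannot
tell, at O(1) entropy cost uniformly in N, where the tagged boson sits. With PalmJensen it gives
PalmAffinityBound for bounded v (C ↦ C/2… e^(C/2)); by PositiveTypeJastrowKL its long-range pair
part costs at most u(0) − u(r), so only the short-range pair part (crude bound 4πK²ρaξ² = O(1)) and
the many-body remainder (PhononDressing) are at stake. [difficulty: open-problem] (why it might
fail: KL is the Palm MEAN of the full landscape increment: a triplet/backflow part of −log Ψ₀ with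
û₃ ∼ k⁻¹ infrared weight makes it grow like log L even if the affinity stays bounded (Jensen loss);
hard cores give KL = +∞ (hence bounded v); the witness must be translation-invariant.) [Reatto1969,
ReattoChester1967, CampbellFeenberg1969, LSSY2005,
Literature.Barriers.AtomisticToContinuum.BogoliubovPerturbationInfraredNarrow, PeilenSerfaty2025]
#4 BoundaryTransferWeak (crux) — shared verbatim with route BECPeriodicReduction
(stmt-AtomisticToContinuum-0827): for each repulsive finite-range v, PeriodicBEC(v) (constant-mode
occupation ≥ cN for δ-near-minimisers of the periodic energy at all small ρ) implies ∃ρ₀>0 ∀ρ∈(0,ρ₀)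
HasGroundStateBEC v ρ (Dirichlet, mode-free). [difficulty: L] (why it might fail: PeriodicBEC(v) is
ground-state-only (δ after N): the Dirichlet ground state restricted to interior cells is neither
periodic nor of sharp N and lies a wall term ≫ δ above E₀^per, so the hypothesis may never fire;
only the ENERGY transfer is in print; BEC is BC-sensitive (Robinson1976).)
[LiebSeiringerSolovejYngvason2005, Basti2022, BoccatoSeiringer2023, Junge2026, Robinson1976,
LauwersVerbeureZagrebnov2003]
#5 PeriodicRigidity (crux) — torus form of BECPalmLandscape.GroundStateRigidity (stmt-3298): for
every admissible v, ρ < ρ₀(v), eventually in N, for every η > 0 there is δ > 0 such that any two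
δ-near-minimisers Ψ, Φ of the periodic energy (L = (N/ρ)^(1/3)) satisfy ∫_(cell^N)|Ψ − cΦ|² ≤ η for
some unit complex c (E₀^per < ∞, compact resolvent, unique positive ground state and a spectral gap
at fixed N; hard cores via low-density connectivity of the torus hard-sphere configuration space).
[difficulty: M] (why it might fail: v = ⊤ walls (hard cores, hollow impenetrable shells ⊤·1_[r₁,r₂])
disconnect the fixed-N configuration space; uniqueness then needs every non-dilute component (jammed
or bound clusters) to lie an N-uniform gap above E₀^per, and E₀^per = ⊤ would make the item
vacuous-false.) [ReedSimonIV1978, BaryshnikovBubenikKahle2013, LSSY2005, Fournais2020]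
#6 HardCorePalmAffinity (crux) — HARD-CORE PALM AFFINITY, shared verbatim with route
BECLiebAntibunching (stmt-AtomisticToContinuum-10241; two-layer plan (i), filed 2026-08-16 to clear
route.target-unreachable): the body of PalmAffinityBound for the admissible v that are NOT bounded
(¬∃M ∀r, v r ≤ M: hard spheres ⊤·1_[0,a], impenetrable shells, singular soft cores), the complement
of the bounded class of TeleportEntropyBound, where KL(P_x‖P_y) = +∞ voids the entropy currency;
foreseen mechanisms: (a) event-conditioned Jensen γ(x,y)/γ(x,x) ≥ P_x(U_y)·exp(−½E_x[Δ_xy | U_y]),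
U_y = {y not covered by the cores of Y}, P_x(U_yᶜ) ≤ (4π/3)ρa³ sup g₂ = O(ρa³) (a CONDITIONAL
teleportation entropy of C¹ approximants of the hard-core ground state); (b) earned uniformity:
TeleportEntropyBound-type bounds for the truncations v⊓M with (ρ₀, C, N-threshold) uniform in M
(a(v⊓M) ↑ a(v) ≤ R₀) plus fixed-N monotone convergence of the closed forms (E₀^per(v⊓M) ↑ E₀^per(v),
ground states converge in L² through the fixed-N gap; Kato1966 VIII §3, ReedSimonIV1978) and a
core-respecting C¹ regularisation. [difficulty: open-problem] (why it might fail: = the target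
verbatim on the unbounded subclass: N-uniform ODLRO of positive hard-sphere near-ground states is
conjunct-strength (LSSY2005 Ch. 5); d = 1 fails (Girardeau state, γ ∼ r^(−1/2) = rung s = 0);
truncation constants C(v⊓M) may blow up as M → ∞.) [LSSY2005, Dyson1957, LiebYngvason1998,
ReattoChester1967, PenroseOnsager1956, KalosLevesqueVerlet1974, GiorginiBoronatCasulleras1999,
Kato1966, Literature.Barriers.AtomisticToContinuum.OneDimensionalHardCore]
#9 PositiveTypeJastrowKL (support) — POSITIVE-TYPE PRINCIPLE (Reatto-type, elementary; the engine of
the ladder). For L > 0, any n, and u : ℝ³ → ℝ continuous, even, Lℤ³-periodic and conditionally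
positive-definite (Σ_i c_i = 0 ⇒ Σ_ij c_i c_j u(z_i − z_j) ≥ 0), with U(X) = Σ_(i<j) u(X_i − X_j) on
(n+1)-configurations: ∫_(cell^n) e^(−U(x,Y)) (U(y,Y) − U(x,Y)) dY ≤ (u(0) − u(x−y)) ∫_(cell^n)
e^(−U(x,Y)) dY for all x, y. Proof: translation invariance gives E_(P_x)[ΔU] = ρ[(u∗h)(r) −
(u∗h)(0)] = L⁻³Σ_(k≠0) û(k)(1 − S(k))(1 − cos k·r) with ρĥ(k) = S(k) − 1, and S(k) ≥ 0, û(k) ≥ 0,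
L⁻³Σ_(k≠0)û(k)cos k·r = u(r) − û(0)L⁻³ (Bochner on the torus: absolutely convergent series).
[difficulty: provable-now] [Reatto1969, Chester1970, ReattoChester1967, McMillan1965]
#9 RieszKernelPositiveType (support) — THE LADDER'S KERNELS. For 0 < s < 3 there is C(s) such that
for all L, η > 0 the smeared zero-mean periodic Riesz-s kernel g(x) = K_s ∫_(η²)^∞ t^((1−s)/2)
(Σ_(m∈ℤ³) heatKernel t (x − Lm) − L⁻³) dt, K_s = (4π)^(3/2) 4^(−s/2)/Γ(s/2) (heat-kernel
subordination: K_s∫₀^∞ t^((1−s)/2) G_t(x) dt = |x|^(−s); s = 1: 4π∫G_t = 1/|x|, cf.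
lintegral_Ioi_heatKernel), is continuous, even, Lℤ³-periodic, conditionally positive-definite (ĝ(k)
= K_s∫_(η²)^∞ t^((1−s)/2) e^(−t|k|²) dt > 0 for k ≠ 0, ĝ(0) = 0) and has g(0) − g(z) ≤ C η^(−s) for
all z, UNIFORMLY IN L (g(0) − g(z) ≤ 2g(0), 0 ≤ Θ_L(t,0) − L⁻³ ≲ (4πt)^(−3/2) + O(L⁻³)·1_(t ≲ L²)).
This is where the exponent acts: for s ≤ 0 the same integral grows like log(L/η) (s = 0) or L^(|s|).
[difficulty: provable-now] [Lewin2022, Serfaty2024, CaffarelliSilvestre2007, PetracheSerfaty2015]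
#9 RieszJastrowCondensate (support) — THE LADDER THEOREM (card rungs R1 = s=1
Bijl–Dingle–Jastrow/one-component plasma and R2 = s=2 phonon class, now for all 0<s<3 and EVERY
coupling b, smearing η, N): for the smeared Riesz-s Jastrow state ψ = exp(−(b/2)Σ_(i<j) g(X_i−X_j))
on the torus, condensateOccupation ≥ exp(−C(s) b η^(−s)) (n+1) ‖ψ‖²_(cell^(n+1)) — TL-BEC of an
explicit correlated translation-invariant 3-D Bose wave function whose |ψ|² is the canonical smeared
Riesz gas at inverse temperature b (any phase of that gas, cf. Chester1970 supersolid remark).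
Corollary of PositiveTypeJastrowKL + RieszKernelPositiveType + PalmJensen + the Fubini step of
PalmAffinityFlatMode; at η = ξ, b = 2π^(−3/2)a^(1/2)ρ^(−1/2) the bound reads n₀/N ≥
exp(−(4/√π)√(ρa³)) = 1 − 2.26√(ρa³) vs Bogoliubov's 1 − 1.505√(ρa³). [difficulty: provable-now]
[Reatto1969, ReattoChester1967, McMillan1965, Chester1970, PenroseOnsager1956]
#9 PalmJensen (support) — PALM–JENSEN. For a continuous strictly positive ψ on (n+1)-configurations
with x-independent slice mass Z = ∫_(cell^n) ψ(x,Y)² dY: if ∫ψ(x,Y)² log(ψ(x,Y)²/ψ(y,Y)²) dY ≤ K·Z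
for all x, y then e^(−K/2) Z ≤ ∫ψ(x,Y)ψ(y,Y) dY (Jensen for exp under p_x = ψ(x,·)²/Z: E[√(p_y/p_x)]
≥ exp(−½KL(p_x‖p_y))). [difficulty: provable-now] [Reatto1969, McMillan1965, PenroseOnsager1956]
#9 PalmAffinityFlatMode (support) — AFFINITY ⇒ FLAT MODE. For L > 0 and a nonnegative periodic trial
state Ψ of n+1 bosons with ∫|Ψ(x,Y)|² dY ≤ e^C ∫|Ψ(x,Y)||Ψ(y,Y)| dY for all x, y:
condensateOccupation ≥ e^(−C)(n+1) (n₀ = (n+1)L⁻³∫_cell∫_cell∫_(cell^n) Ψ(x,Y)Ψ(y,Y); Fubini for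
x::Y through the cell indicators of condensateOccupation; ∫_cell∫_(cell^n)|Ψ(x,Y)|² = 1).
[difficulty: provable-now] [PenroseOnsager1956, LSSY2005, Fournais2020]
#9 PeriodicOccupationStability (support) — OCCUPATION STABILITY on the torus: for periodic trial
states Ψ, Φ of N bosons and |c| = 1, condensateOccupation(Ψ)^(1/2) ≤ condensateOccupation(Φ)^(1/2) +
N^(1/2) (∫_(cell^N)|Ψ − cΦ|²)^(1/2) (F_Ψ(Y) = ⟨φ₀, Ψ(·,Y)1_cell⟩, |F_Ψ − F_(cΦ)| ≤ ‖(Ψ −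
cΦ)(·,Y)‖_(L²(cell)), Minkowski in L²(cell^(N−1)); occ(cΦ) = occ(Φ)). [difficulty: provable-now]
[LSSY2005, Fournais2020]
#9 AffinityFrameGlue (support) — FRAME GLUE (pure bookkeeping once the two support inequalities are
available; filed as an item so that the deciding theorem `closes` is term-mode logic):
PalmAffinityBound → PeriodicRigidity → PalmAffinityFlatMode → PeriodicOccupationStability →
PeriodicBEC-body (verbatim the body of stmt-AtomisticToContinuum-0826: ∀ admissible v ∃ρ₀ ∀ρ<ρ₀ ∃c>0
∀ᶠN ∃δ>0 ∀ δ-near-minimisers Ψ of the periodic energy, c·N ≤ condensateOccupation). Proof: fix v; ρ₀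
= min; c := e^(−C)/4; eventually in N = n+1 (index shift n ↦ n+1 under atTop) take η := e^(−C)/4 in
PeriodicRigidity to get δ; the ∃-witness Ψ of PalmAffinityBound at δ has condensateOccupation ≥
e^(−C)N by PalmAffinityFlatMode; for any δ-near-minimiser Φ, rigidity + PeriodicOccupationStability
give condensateOccupation(Φ)^(1/2) ≥ (e^(−C)N)^(1/2) − (Nη)^(1/2) = (e^(−C)N)^(1/2)/2. ENNReal
arithmetic only. [difficulty: provable-now] [LSSY2005, PenroseOnsager1956]
#10 AffinityOfEntropy (support; stmt-AtomisticToContinuum-14579; rank 10 is render order only, a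
relic of the rev-10 form that named the rank-9 support PalmJensen as a hypothesis; superseded forms
stmt-14240/14376/14569) — GLUE TO THE TARGET FROM THE CRUXES (two-layer plan (i), filed 2026-08-16;
clears route.target-unreachable): TeleportEntropyBound → HardCorePalmAffinity → PalmAffinityBound,
the support PalmJensen (stmt-9162) entering as a LEMMA inside the proof (gate rule 2026-08-16: only
crux items are hypotheses, supports are proved lemmas — with PalmJensen as a hypothesis the gate did
not count the target as derived and auto-badged PalmAffinityBound `crux (kind.auto-crux)` at rev
11). Proof (bookkeeping; candidate GlueProofFinal.lean proves `PalmJensen → AffinityOfEntropy`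
sorry-free, lean rc 0 incl. the Bochner→lintegral conversion, attached as evidence on the item): fix
v; by_cases ∃ M : NNReal, ∀ r, v r ≤ M. Unbounded: HardCorePalmAffinity verbatim. Bounded:
TeleportEntropyBound gives ρ₀, C and, eventually in n, for every δ a δ-near-minimiser Ψ with re Ψ >
0 = im Ψ (so Ψ.ψ = ↑‖Ψ.ψ‖), x-independent slice mass and KL ≤ C·mass; PalmJensen (ψ := ‖Ψ.ψ‖, K :=
C, L := sideLength ρ (n+1) > 0) gives e^(−C/2)∫‖Ψ(x,Y)‖² ≤ ∫‖Ψ(x,Y)‖‖Ψ(y,Y)‖; take C' := C/2 and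
convert Bochner → lintegral (continuous integrands on the bounded cell: Bornology.IsBounded.pi,
IsBounded.isCompact_closure, ContinuousOn.integrableOn_compact; ofReal_integral_eq_lintegral_ofReal,
ENNReal.ofReal_mul). PENDING (badge glue.non-crux-hypothesis, same gate rule): `closes` still
assumes the supports PalmAffinityFlatMode, PeriodicOccupationStability, AffinityFrameGlue; once they
are PROVED (all provable-now, rank 9) re-supply it crux-only as `closes (hA : PalmAffinityBound) (hR
: PeriodicRigidity) (hT : BoundaryTransferWeak) := fun v hv => hT v hv ((affinityFrameGlue hA hR
palmAffinityFlatMode periodicOccupationStability) v hv)`, and once PalmJensen + AffinityOfEntropy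
are proved, as `closes (hTE : TeleportEntropyBound) (hH : HardCorePalmAffinity) (hR) (hT)` through
`affinityOfEntropy hTE hH`. [difficulty: provable-now] [Reatto1969, PenroseOnsager1956, LSSY2005]

TWO-LAYER PLAN. Foreseen glued splits. (i) FILED 2026-08-16 (route-choice repair of
route.target-unreachable, option (a)): AffinityOfEntropy : TeleportEntropyBound →
HardCorePalmAffinity → PalmAffinityBound (support, bookkeeping via the lemma PalmJensen, C ↦ C/2 in
the e^C convention of the target) with the residual crux HardCorePalmAffinity (rank 6 here; =
stmt-AtomisticToContinuum-10241 of BECLiebAntibunching, already grounded and checked) = the target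
on the unbounded class; inside it the event-conditioned Jensen for ⊤-cores (A ≥ P_x(y uncovered)·
exp(−½E[Δ | uncovered]), P_x(covered) = O(ρa³)) or earned uniformity over the truncations v⊓M are
the foreseen lines (not decomposed). (ii) TeleportEntropyBound ⇐ ShortRangePairIncrement →
PhononDressing → TeleportEntropyBound
with the glue PositiveTypeJastrowKL applied to the TRUE Born measure (its proof uses only S_Ψ₀(k) ≥
0, so the long-range pair part
b·g_(2,L,ξ) costs ≤ b(g(0) − g(r)) ≤ (4/√π)√(ρa³)·O(1) for free); ShortRangePairIncrement =
|ρ[(w∗h)(r) − (w∗h)(0)]| ≤ C for the explicit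
short-range pair part w (range Kξ, ρ∫|w| ≤ 4πK²ρaξ²·O(1) = O(1), needs sup g₂ < ∞ for Ψ₀);
PhononDressing = the informal rank-3 crux filed
at open (many-body remainder). (iii) PeriodicRigidity ⇐ FinitePeriodicEnergy →
UniqueGappedGroundState → PeriodicRigidity (as
BECPalmLandscape's plan). (iv) Once (ii) closes for bounded v, a Dirichlet-direct variant shares
BECPalmLandscape's frame (X_B1 glue proved).

KILL CRITERIA. ¬PalmAffinityBound for some admissible v at arbitrarily small ρ (a positive torus
ground state without uniform ODLRO) refutes the target and
closes the route `refuted:PalmAffinityBound` (and BECPalmLandscape's foreseen torus child);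
¬HardCorePalmAffinity (a hard-sphere or hollow-shell torus near-ground state without N-uniform ODLRO
at small ρ) is the same event on the unbounded subclass — it refutes the target too, unless the
bounded line (TeleportEntropyBound → PalmJensen) is then carried into a bounded-class route (restate
X with the boundedness hypothesis and a bounded-class conjunct transfer such as HardCoreExtension,
stmt-11786); if only the KL currency fails (¬TeleportEntropyBound
with the affinity still bounded: log L growth of the Palm mean by a marginal collective tail) pivot
to the affinity/exponential-moment version
of PhononDressing (card R2/R3 as printed, PeilenSerfaty2025-type fluctuation input) — restate rank
2, do not close. ¬PeriodicRigidity for a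
hollow-shell v kills every near-minimiser frame on the torus: pivot = restrict the class or prove
energetic dominance of the dilute component.
¬BoundaryTransferWeak is shared with
BECPeriodicReduction/BECGaussianDomination/BECVortexSheetDuality: pivot to the Dirichlet-direct
frame of
BECPalmLandscape (bec_of_zeroMode proved). A refutation of a SUPPORT item (PositiveTypeJastrowKL,
RieszKernelPositiveType) would mean a
mis-typing (junk values of the subordinated kernel, a missing summability), not a dead line:
restate. PeriodicBEC (0826) or X_B1 (0686) proved
elsewhere moots the frame, not the ladder theorems.

NOT DECOMPOSED YET. The norm of PhononDressing (informal until the short-range/many-body split of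
−log Ψ₀² is typed: it needs the zero-energy scattering
solution f_v as a function and a smooth truncation at Kξ); hard cores in the KL currency
(event-conditioned Jensen, layer 2 of (i)); the
negative rung s = 0 (3-D log-gas Jastrow state: n₀ ≍ N^(1−b/2·…), no BEC) and s < 0;
exponential-moment (UV-smoothed) versions of the
ladder (card R1/R2 as printed) — not needed since Jensen uses only the Palm mean;
existence/regularity of the periodic ground state as a
PeriodicTrialState for bounded v (W^(2,p) ⇒ C^(1,α)), used only to see that the ∃-witnesses exist;
positive temperature; Dirichlet walls.

CHEAPEST FALSIFIER. (a) By hand (done while planning, consistent): the identity KL(P_x‖P_y) =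
L⁻³Σ_(k≠0)û(k)(1−S(k))(1−cos k·r) and the bound ≤ u(0) − u(r) —
a refuter re-derives it in ten lines (translation invariance, ρĥ = S − 1, S ≥ 0, û ≥ 0); if it
fails, all three ladder supports fall and
the route reverts to the card's screening cruxes. (b) Numerics against RieszJastrowCondensate at η =
ξ: n₀/N ≥ 1 − 2.26√(ρa³) must sit below
VMC condensate fractions of Reatto–Chester Jastrow states (McMillan1965-type runs; kit not run —
this seat is compute-free). (c) Literature:
read Reatto1969 (paywalled, acq-01364, cite-only) — if his 'class' is exactly the
positive-Fourier-transform pseudopotentials with this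
Jensen bound, the supports are 'known' (fine: they are filed as support) and only ranks 2–3 carry
novelty. (d) For rank 2: the Bogoliubov
(harmonic-in-ρ̂_k) ground state IS a positive-type pair state with û = (1/S − 1)/ρ but u(0) =
(4a/π)∫dk = ∞ (the 2a/r core): confirms that
the split long-range (free) / short-range (crude) / many-body (crux) is forced, and that no pure
pair ansatz closes rank 2.

NUMBERS. K_s = (4π)^(3/2)4^(−s/2)/Γ(s/2): K_1 = 4π, K_2 = 2π^(3/2); smeared self-energies g_η(0) ≈
(2/s)K_s(4π)^(−3/2)η^(−s): s = 2: 1/(4η²), s = 1: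
1/(√π η); Onsager/positive-type bound Σ_(i<j)g ≥ −(n+1)g(0)/2. Physical dictionary (ħ = 2m = 1, LSSY
units): c = 4√(πρa), ξ = (8πρa)^(−1/2),
b = c/(2π²ρ) = 2π^(−3/2)a^(1/2)ρ^(−1/2), Γ = bρ^(2/3) = 2π^(−3/2)(ρa³)^(1/6), ξρ^(1/3) =
(8π)^(−1/2)(ρa³)^(−1/6); at η = ξ: b g_ξ(0) = b/(4ξ²) =
(4/√π)√(ρa³) (card: landscape variance (8/√π)√(ρa³)), so n₀/N ≥ exp(−(4/√π)√(ρa³)) ≈ 1 − 2.257√(ρa³)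
against Bogoliubov 1 − (8/(3√π))√(ρa³) =
1 − 1.505√(ρa³). Short-range budget 4πρaξ² = 1/2. Free periodic gas: n₀ = N, KL = 0. Items at open:
12 typed (1 target, 1 assembly, 3 cruxes,
7 support) + 1 informal crux (PhononDressing, rank 3) + 1 definition request
(defn-PeriodicRieszKernel, filed); +2 at the 2026-08-16 target-reachability repair
(HardCorePalmAffinity crux rank 6 shared with BECLiebAntibunching, AffinityOfEntropy support): 14
typed (1 target, 1 assembly, 4 cruxes, 8 support) + PhononDressing informal.

DEFINITION REQUESTS. (1) `PeriodicRieszKernel s L η : Space → ℝ` (topic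
Literature/MathematicalPhysics/StatisticalMechanics or Literature/Analysis/HarmonicAnalysis): the
heat-subordinated smeared zero-mean periodic Riesz kernel inlined in
RieszKernelPositiveType/RieszJastrowCondensate, with API: continuity,
evenness, Lℤ³-periodicity, Fourier coefficients K_s∫_(η²)^∞ t^((1−s)/2)e^(−t|k|²)dt ≥ 0, zero
cell-mean, g(0) ≤ C_s η^(−s), |g(x) − |x|^(−s)| small
for η ≪ |x| ≪ L; once landed the two supports can be restated over it (same meaning). (2) For typing
PhononDressing: the zero-energy
scattering solution f_v of (−Δ + ½v)f = 0 as a FUNCTION with f_v(r) = 1 − a/r beyond the range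
(PeriodicBoseGasScatteringSolution.lean has
the ODE layer) and a smooth radial cut-off; no new notion is needed for the typed items
(PeriodicTrialState, periodicEnergy,
periodicGroundStateEnergy, condensateOccupation, cellN, latticeVec, sideLength, heatKernel all
exist).

Novelty: Searches (2026-08-15, this seat; local searchd flaky, arXiv/OpenAlex/S2 HTTP 429): `lit search
--hybrid "Jastrow wave function off-diagonal
long-range order condensate fraction rigorous bound"` (12 textbook hits: LSSY2005 pp.47,136,
Griffin1993 p.188 'Jastrow–Feenberg states do lead
to n₀ > 0' — no theorem); `lit search --source crossref` ×5 ("off-diagonal long-range order Jastrow"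
→ Reatto1969, KonigVogelZass2025
doi:10.1214/25-aap2213 free gas; "BEC Jastrow classical fluid analogy Reatto" →
doi:10.1103/physrev.183.334, doi:10.1103/physreva.18.296;
"Chester speculations" → Chester1970 doi:10.1103/physreva.2.256; "Debye screening jellium" →
Imbrie1983 doi:10.1007/bf01208264,
BrydgesFederbush1980, Brydges1978 doi:10.1007/bf01614227, Yang1987 doi:10.1007/bf01009952; "local
laws super-Coulombic Riesz" →
ArmstrongSerfaty2021 doi:10.1214/20-aop1445, Serfaty Colloquium ch. 8/10 doi:10.1090/coll/070/08,10;
"OCP decay of correlations Riesz" →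
physics only, doi:10.1103/physreve.59.1435); `lit search --source zbmath "Riesz gas Bose
condensation"` (0); `lit vsearch` ×2 (Reatto/Chester
theorem statements: no held source states them); `lit galaxy search --star all "Jastrow wave
function off-diagonal long-range order"` (queue
saturated, 0 rows) and `--star panama "condensation of Jastrow"` (0); `lit frontier
AtomisticToContinuum --since 2022` (30 rows: Junge2026,
ChongLiangNam2026, arXiv:2605.06844 — energy/localisation lines only); `lit bridges
AtomisticToContinuum --cross any` (no Coulom  [refs: 10.1214/25-aap2213, 10.1103/physrev.183.334, 10.1103/physreva.18.296, 10.1103/physreva.2.256, 10.1007/bf01208264, 10.1007/bf01614227, 10.1007/bf01009952, 10.1214/20-aop1445, 10.1090/coll/070/08, 10.1103/physreve.59.1435, 2605.06844, 2511.18623, 1201.2227, doi:10.1214/25-aap2213, doi:10.1103/physrev.183.334, doi:10.1103/physreva.18.296, doi:10.1103/physreva.2.256, doi:10.1007/bf01208264, doi:10.100]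

Barriers (technique_class: riesz-gas, palm-affinity, positive-type, positivity, jastrow): - technique_class: riesz-gas, palm-affinity, positive-type, positivity, jastrow
- Literature.Barriers.AtomisticToContinuum.KineticGapLengthScales: evaded — no kinetic gap, Poincaré
inequality or energy window at scale L is an input; δ is chosen after N and used only for
L²-rigidity at fixed N; the state enters through positivity and its Palm laws, the exit that
KineticGapLengthScalesNarrow scope (b′) names as open; the constant is e^(−O(1)), not 1 − o(1).
- Literature.Barriers.AtomisticToContinuum.KineticGapLengthScalesNarrow: not in the energy-window
class — PalmAffinityBound/TeleportEntropyBound are existential over near-minimisers and are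
properties of the positive ground state, false for generic states in the window.
- Literature.Barriers.AtomisticToContinuum.EnergyAsymptoticsWithoutCondensation: evaded — no energy
asymptotics are matched; the only energy fact used is the positive-type (Onsager) bound Σ_(i<j)g ≥
−(n+1)g(0)/2 for the reference gas, and the 1-D witness sits at s = 0 where the ladder itself
predicts no BEC.
- Literature.Barriers.AtomisticToContinuum.BogoliubovPerturbationInfrared: the ladder supports are
statements about real Gibbs weights (gauge-invariant, no expansion in ψ, ψ̄); the d = 3 marginality
can re-enter only through the many-body remainder in TeleportEntropyBound/PhononDressing — flagged
there as the rank-2/3 risk, not evaded by fiat.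
- Literature.Barriers.AtomisticToContinuum.BogoliubovPerturbationInfraredNarrow: same; the object
bounded (a rela

History (route lifecycle, newest last):
- 2026-08-15T16:15:48Z · rev 6: restated Assembly (stmt-AtomisticToContinuum-9166) — restate Assembly (stmt-9166) 1:1 to clear its stale BLOCKED(missing BoundaryTransferWeak) render marker now that BoundaryTransferWeak is listed again (rev 4); s (planner-rbadge-AtomisticToContinuum-BECRieszSh-2f848e88-g2-0)
- 2026-08-16T03:17:54Z · rev 8: restated AffinityOfEntropy (stmt-AtomisticToContinuum-14240) — re-materialise the glue stmt-14240 (rendered BLOCKED at rev 7: support items render in item-id order, so its def precedes PalmJensen stmt-9162): restate 1:1 wit (planner-rchoice-AtomisticToContinuum-BECRieszS-f8808839-0)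
- 2026-08-16T03:27:10Z · rev 9: dropped stmt-AtomisticToContinuum-14376 — render-order fix, step 1/2: drop the rank-9 glue stmt-14376 (PalmJensen inlined) to re-add the NAMED glue TeleportEntropyBound → PalmJensen → HardCorePalmAffini (planner-rchoice-AtomisticToContinuum-BECRieszS-f8808839-0)
- 2026-08-16T03:43:37Z · AUTO-CRUX (edit): PalmAffinityBound — hypotheses of the deciding theorem that nothing in the route derives are cruxes (planner-rchoice-AtomisticToContinuum-BECRieszS-f8808839-0)
- 2026-08-16T03:58:36Z · rev 12: restated AffinityOfEntropy (stmt-AtomisticToContinuum-14569) — crux-only glue: restate AffinityOfEntropy 1:1 as TeleportEntropyBound → HardCorePalmAffinity → PalmAffinityBound (both antecedents cruxes); the support PalmJens (planner-rchoice-AtomisticToContinuum-BECRieszS-f8808839-0)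
- 2026-08-16T16:41:56Z · AUTO-CRUX (backfill): PalmAffinityBound — hypotheses of the deciding theorem that nothing in the route derives are cruxes (operator:999:1813213)
- 2026-08-25T01:54:46Z · DORMANT — reconciler: no traction for 7.3 d (last activity item-evidence-added at 2026-08-17T18:55:01Z); parked, not closed — `ledger route dormant route-AtomisticToConti (operator:999:908762)
- 2026-08-29T03:27:57Z · REACTIVATED — reconciler: reactivated — activity statement-checked at 2026-08-29T01:17:37Z after parking at 2026-08-25T01:54:46Z (operator:999:228292)

sub-problem: BoseEinsteinCondensation · status: open · opened planner-plancard-AtomisticToContinuum-BoseEin-cc47c68e-0 2026-08-15T13:51:37Z · rev 14 · ledger route-AtomisticToContinuum-BECRieszShadow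
GENERATED by the gate from the ledger (D-0016/17). Provers cite these decls: `theorem foo : Summit.AtomisticToContinuum.BoseEinsteinCondensation.Theses.BECRieszShadow.<Decl> := …` in Summits/AtomisticToContinuum/BoseEinsteinCondensation/Theorems/<Name>.lean.
-/

namespace Summit.AtomisticToContinuum.BoseEinsteinCondensation.Theses.BECRieszShadow

open scoped BigOperators Topology Manifold Classical MeasureTheory ProbabilityTheory Matrix InnerProductSpace ComplexConjugate ContinuousMap
open Filter Set Function TopologicalSpace MeasureTheory

attribute [summit_statement] _root_.BoseEinsteinCondensation

/-- item stmt-AtomisticToContinuum-9157 · crux (kind.auto-crux: conjecture-grade) · rank 0 · open · by planner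
why it might fail: uniform-in-separation ODLRO with e^(−C) needs 2n₀/N − 1 > 0-type control at all r ≤ L√3/2; an unscreened marginal (three-body/backflow) tail of −log Ψ₀ would leave only γ ≥ ρN^(−ε); hard cores enter through the affinity (fine) but forbid the KL currency below.
sources: Reatto1969, PenroseOnsager1956, LSSY2005, ReattoChester1967, PeilenSerfaty2025
[target] X as in § Thesis: for every admissible v, ρ < ρ₀(v), some C, eventually in N = n+1, for
every δ > 0 a nonnegative periodic δ-near-minimiser Ψ with ∫_(cell^n)|Ψ(x,Y)|² dY ≤ e^C
∫_(cell^n)|Ψ(x,Y)||Ψ(y,Y)| dY for all x, y ∈ ℝ³ (card item: Palm–Jensen assembly; the true gas at η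
= ξ predicts C ≈ (4/√π)√(ρa³)). -/
@[route_item "route-AtomisticToContinuum-BECRieszShadow", crux]
def PalmAffinityBound : Prop :=
  ∀ v : ℝ → ENNReal, Literature.MathematicalPhysics.QuantumManyBody.BoseGas.IsRepulsiveFiniteRange v → ∃ ρ₀ : ℝ, 0 < ρ₀ ∧ ∀ ρ : ℝ, 0 < ρ → ρ < ρ₀ → ∃ C : ℝ, ∀ᶠ n : ℕ in Filter.atTop, ∀ δ : ENNReal, 0 < δ → ∃ Ψ : Literature.MathematicalPhysics.QuantumManyBody.BoseGas.PeriodicTrialState (n + 1) (Literature.MathematicalPhysics.QuantumManyBody.BoseGas.sideLength ρ (n + 1)), Literature.MathematicalPhysics.QuantumManyBody.BoseGas.periodicEnergy v Ψ ≤ Literature.MathematicalPhysics.QuantumManyBody.BoseGas.periodicGroundStateEnergy v (n + 1) (Literature.MathematicalPhysics.QuantumManyBody.BoseGas.sideLength ρ (n + 1)) + δ ∧ (∀ X, Ψ.ψ X = (‖Ψ.ψ X‖ : ℂ)) ∧ ∀ x y : Literature.MathematicalPhysics.QuantumManyBody.BoseGas.Space, ∫⁻ Y in Literature.MathematicalPhysics.QuantumManyBody.BoseGas.cellN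 n (Literature.MathematicalPhysics.QuantumManyBody.BoseGas.sideLength ρ (n + 1)), (‖Ψ.ψ (Matrix.vecCons x Y)‖₊ : ENNReal) ^ 2 ≤ ENNReal.ofReal (Real.exp C) * ∫⁻ Y in Literature.MathematicalPhysics.QuantumManyBody.BoseGas.cellN n (Literature.MathematicalPhysics.QuantumManyBody.BoseGas.sideLength ρ (n + 1)), (‖Ψ.ψ (Matrix.vecCons x Y)‖₊ : ENNReal) * (‖Ψ.ψ (Matrix.vecCons y Y)‖₊ : ENNReal)

/-- item stmt-AtomisticToContinuum-9158 · crux · rank 2 · open · by planner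
why it might fail: KL is the Palm MEAN of the full landscape increment: a triplet/backflow part of −log Ψ₀ with û₃ ∼ k⁻¹ infrared weight makes it grow like log L even if the affinity stays bounded (Jensen loss); hard cores give KL = +∞ (hence bounded v); the witness must be translation-invariant.
sources: Reatto1969, ReattoChester1967, CampbellFeenberg1969, LSSY2005, Literature.Barriers.AtomisticToContinuum.BogoliubovPerturbationInfraredNarrow, PeilenSerfaty2025
[crux] TELEPORTATION ENTROPY OF THE TRUE GAS (card R3 in Palm-mean form; bounded potentials). For
every admissible v that is bounded (v ≤ M < ∞), ρ < ρ₀(v), some C, eventually in N = n+1, for every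
δ > 0 there is a strictly positive periodic δ-near-minimiser Ψ (the ground state itself qualifies)
with x-independent slice mass ∫|Ψ(x,Y)|²dY and ∫|Ψ(x,Y)|² log(|Ψ(x,Y)|²/|Ψ(y,Y)|²) dY ≤ C ∫|Ψ(x,Y)|²
dY for all x, y, i.e. KL(P_x‖P_y) ≤ C: the bath cannot tell, at O(1) entropy cost uniformly in N,
where the tagged boson sits. With PalmJensen it gives PalmAffinityBound for bounded v (C ↦ C/2…
e^(C/2)); by PositiveTypeJastrowKL its long-range pair part costs at most u(0) − u(r), so only the
short-range pair part (crude bound 4πK²ρaξ² = O(1)) and the many-body remainder (PhononDressing) are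
at stake. [difficulty: open-problem] -/
@[route_item "route-AtomisticToContinuum-BECRieszShadow", crux]
def TeleportEntropyBound : Prop :=
  ∀ v : ℝ → ENNReal, Literature.MathematicalPhysics.QuantumManyBody.BoseGas.IsRepulsiveFiniteRange v → (∃ M : NNReal, ∀ r, v r ≤ M) → ∃ ρ₀ : ℝ, 0 < ρ₀ ∧ ∀ ρ : ℝ, 0 < ρ → ρ < ρ₀ → ∃ C : ℝ, ∀ᶠ n : ℕ in Filter.atTop, ∀ δ : ENNReal, 0 < δ → ∃ Ψ : Literature.MathematicalPhysics.QuantumManyBody.BoseGas.PeriodicTrialState (n + 1) (Literature.MathematicalPhysics.QuantumManyBody.BoseGas.sideLength ρ (n + 1)), Literature.MathematicalPhysics.QuantumManyBody.BoseGas.periodicEnergy v Ψ ≤ Literature.MathematicalPhysics.QuantumManyBody.BoseGas.periodicGroundStateEnergy v (n + 1) (Literature.MathematicalPhysics.QuantumManyBody.BoseGas.sideLength ρ (n + 1)) + δ ∧ (∀ X, 0 < (Ψ.ψ X).re ∧ (Ψ.ψ X).im = 0) ∧ (∀ x y : Literature.MathematicalPhysics.QuantumManyBody.BoseGas.Space,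 ∫ Y in Literature.MathematicalPhysics.QuantumManyBody.BoseGas.cellN n (Literature.MathematicalPhysics.QuantumManyBody.BoseGas.sideLength ρ (n + 1)), ‖Ψ.ψ (Matrix.vecCons x Y)‖ ^ 2 = ∫ Y in Literature.MathematicalPhysics.QuantumManyBody.BoseGas.cellN n (Literature.MathematicalPhysics.QuantumManyBody.BoseGas.sideLength ρ (n + 1)), ‖Ψ.ψ (Matrix.vecCons y Y)‖ ^ 2) ∧ ∀ x y : Literature.MathematicalPhysics.QuantumManyBody.BoseGas.Space, ∫ Y in Literature.MathematicalPhysics.QuantumManyBody.BoseGas.cellN n (Literature.MathematicalPhysics.QuantumManyBody.BoseGas.sideLength ρ (n + 1)), ‖Ψ.ψ (Matrix.vecCons x Y)‖ ^ 2 * Real.log (‖Ψ.ψ (Matrix.vecCons x Y)‖ ^ 2 / ‖Ψ.ψ (Matrix.vecCons y Y)‖ ^ 2) ≤ C * ∫ Y in Literature.MathematicalPhysics.QuantumManyBody.BoseGas.cellN n (Literature.MathematicalPhysics.QuantumManyBody.BoseGas.sideLength ρ (n + 1)), ‖Ψ.ψ (Matrix.vecCons x Y)‖ ^ 2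

/-- item stmt-AtomisticToContinuum-0827 · crux · rank 4 · open · by planner
why it might fail: PeriodicBEC(v) is ground-state-only (δ after N): the Dirichlet ground state is a periodic trial state but lies a wall term ≫ δ above E₀^per, and interior restrictions are neither periodic nor of sharp N, so the hypothesis may never fire (transfer ≈ conjunct); only the ENERGY transfer is in print.
sources: LiebSeiringerSolovejYngvason2005, Basti2022, BoccatoSeiringer2023, Junge2026, LauwersVerbeureZagrebnov2003, Robinson1976
[crux] BoundaryTransferWeak (mode-free boundary-condition transfer, per potential): for each
repulsive finite-range v, PeriodicBEC(v) implies ∃ρ₀>0 ∀ρ∈(0,ρ₀) HasGroundStateBEC v ρ (Dirichlet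
ground state, λ_max(γ) ≥ cN via condensateNumber). Not glue: near-minimiser slacks are O(N/L²) while
Dirichlet/periodic energies differ by a boundary term ≫ N/L², so no energy-comparison proof;
expected route: Neumann bracketing of interior sub-boxes (−Δ_Dir ≥ ⊕−Δ_Neu, v ≥ 0) + a mode-free
criterion (λ_max ≥ tr γ²/N). Only the ENERGY analogue is in print (LiebSeiringerSolovejYngvason2005
Ch. 2 after (2.8)). v ≡ 0: hypothesis and conclusion both true. -/
@[route_item "route-AtomisticToContinuum-BECRieszShadow", crux]
def BoundaryTransferWeak : Prop :=
  ∀ v : ℝ → ENNReal, Literature.MathematicalPhysics.QuantumManyBody.BoseGas.IsRepulsiveFiniteRange v → (∃ ρ₀ : ℝ, 0 < ρ₀ ∧ ∀ ρ : ℝ, 0 < ρ → ρ < ρ₀ → ∃ c : ℝ, 0 < c ∧ ∀ᶠ N : ℕ in Filter.atTop, ∃ δ : ENNReal, 0 < δ ∧ ∀ Ψ : Literature.MathematicalPhysics.QuantumManyBody.BoseGas.PeriodicTrialState N (Literature.MathematicalPhysics.QuantumManyBody.BoseGas.sideLength ρ N), Literature.MathematicalPhysics.QuantumManyBody.BoseGas.periodicEnergy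 v Ψ ≤ Literature.MathematicalPhysics.QuantumManyBody.BoseGas.periodicGroundStateEnergy v N (Literature.MathematicalPhysics.QuantumManyBody.BoseGas.sideLength ρ N) + δ → ENNReal.ofReal (c * N) ≤ Literature.MathematicalPhysics.QuantumManyBody.BoseGas.condensateOccupation N (Literature.MathematicalPhysics.QuantumManyBody.BoseGas.sideLength ρ N) Ψ.ψ) → ∃ ρ₀ : ℝ, 0 < ρ₀ ∧ ∀ ρ : ℝ, 0 < ρ → ρ < ρ₀ → Literature.MathematicalPhysics.QuantumManyBody.BoseGas.HasGroundStateBEC v ρ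

/-- item stmt-AtomisticToContinuum-9467 · crux · rank 5 · open · by planner
why it might fail: v = ⊤ walls (hard cores, hollow impenetrable shells ⊤·1_[r₁,r₂]) disconnect the fixed-N configuration space; uniqueness then needs every non-dilute component (jammed or bound clusters) to lie an N-uniform gap above E₀^per, and E₀^per = ⊤ would make the item vacuous-false.
sources: ReedSimonIV1978, BaryshnikovBubenikKahle2013, LSSY2005, Fournais2020
[crux] PERIODIC RIGIDITY (torus ground-state rigidity; weakened η-first form, re-filed as a LISTED
item of route BECRieszShadow because the identical ∀ᶠN-first statement
stmt-AtomisticToContinuum-6516 was closed moot with the retired routes): for every admissible v, ρ <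
ρ₀(v), every η > 0, eventually in N, there is δ > 0 such that any two δ-near-minimisers Ψ, Φ of the
periodic energy (L = (N/ρ)^(1/3)) satisfy ∫_(cell^N)|Ψ − cΦ|² ≤ η for some unit complex c (E₀^per <
∞, compact resolvent, unique positive ground state and a spectral gap at fixed N; hard cores via
low-density connectivity of the torus hard-sphere configuration space). This is exactly what
AffinityFrameGlue consumes (η := e^(−C)/4 is fixed before N). Why it might fail: v = ⊤ walls (hard
cores, hollow impenetrable shells ⊤·1_[r₁,r₂]) disconnect the fixed-N configuration space;
uniqueness then needs every non-dilute component (jammed or bound clusters) to lie an N-uniform gap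
above E₀^per, and E₀^per = ⊤ would make the item vacuous-false. Sources: ReedSimonIV1978
XIII.12/XIII.47; BaryshnikovBubenikKahle2013 = doi:10.1093/imrn/rnt012; LSSY2005 Ch. 2; Fournais2020
(1.1)–(1.2). [difficulty: M] -/
@[route_item "route-AtomisticToContinuum-BECRieszShadow", crux]
def PeriodicRigidity : Prop :=
  ∀ v : ℝ → ENNReal, Literature.MathematicalPhysics.QuantumManyBody.BoseGas.IsRepulsiveFiniteRange v → ∃ ρ₀ : ℝ, 0 < ρ₀ ∧ ∀ ρ : ℝ, 0 < ρ → ρ < ρ₀ → ∀ η : ℝ, 0 < η → ∀ᶠ N : ℕ in Filter.atTop, ∃ δ : ENNReal, 0 < δ ∧ ∀ Ψ Φ : Literature.MathematicalPhysics.QuantumManyBody.BoseGas.PeriodicTrialState N (Literature.MathematicalPhysics.QuantumManyBody.BoseGas.sideLength ρ N), Literature.MathematicalPhysics.QuantumManyBody.BoseGas.periodicEnergy v Ψ ≤ Literature.MathematicalPhysics.QuantumManyBody.BoseGas.periodicGroundStateEnergy v N (Literature.MathematicalPhysics.QuantumManyBody.BoseGas.sideLength ρ N) + δ → Literature.MathematicalPhysics.QuantumManyBody.BoseGas.periodicEnergy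 v Φ ≤ Literature.MathematicalPhysics.QuantumManyBody.BoseGas.periodicGroundStateEnergy v N (Literature.MathematicalPhysics.QuantumManyBody.BoseGas.sideLength ρ N) + δ → ∃ c : ℂ, ‖c‖ = 1 ∧ ∫⁻ X in Literature.MathematicalPhysics.QuantumManyBody.BoseGas.cellN N (Literature.MathematicalPhysics.QuantumManyBody.BoseGas.sideLength ρ N), (‖Ψ.ψ X - c * Φ.ψ X‖₊ : ENNReal) ^ 2 ≤ ENNReal.ofReal η

/-- item stmt-AtomisticToContinuum-10241 · crux · rank 6 · open · by planner
why it might fail: = the target verbatim on the unbounded subclass (hard spheres/shells): N-uniform ODLRO of positive near-ground states is conjunct-strength; KL = +∞ voids the entropy currency, leaving event-conditioned Jensen or M-uniform truncation constants, both unprinted; d = 1 fails (γ ∼ r^(−1/2)).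
sources: LSSY2005, Dyson1957, LiebYngvason1998, ReattoChester1967, PenroseOnsager1956, KalosLevesqueVerlet1974
[crux] HARD-CORE PALM AFFINITY: the body of PalmAffinityBound for the members of the class that are
NOT bounded (v taking the value ⊤ or unbounded finite values: hard spheres, hard core plus tail).
Filed as a crux because the positivity engine above is typed on exact C¹ ground states, which do not
exist for hard cores (Ψ₀ is Lipschitz at contact): the ∃-witness must be a C¹ near-minimiser
approximating Ψ₀, with the event-conditioned Jensen γ(x,y)/ρ ≥ P_x(A_y)·exp(−E[Δ | A_y]), P_x(A_y) ≥
1 − (4π/3)ρa³ sup g₂ (anti-bunching of the approximant supplies the void bound). [deps: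
AntibunchingGS, NonPairwisePalmMean] [difficulty: open-problem] -/
@[route_item "route-AtomisticToContinuum-BECRieszShadow", crux]
def HardCorePalmAffinity : Prop :=
  ∀ v : ℝ → ENNReal, Literature.MathematicalPhysics.QuantumManyBody.BoseGas.IsRepulsiveFiniteRange v → (¬ ∃ M : NNReal, ∀ r, v r ≤ M) → ∃ ρ₀ : ℝ, 0 < ρ₀ ∧ ∀ ρ : ℝ, 0 < ρ → ρ < ρ₀ → ∃ C : ℝ, ∀ᶠ n : ℕ in Filter.atTop, ∀ δ : ENNReal, 0 < δ → ∃ Ψ : Literature.MathematicalPhysics.QuantumManyBody.BoseGas.PeriodicTrialState (n + 1) (Literature.MathematicalPhysics.QuantumManyBody.BoseGas.sideLength ρ (n + 1)), Literature.MathematicalPhysics.QuantumManyBody.BoseGas.periodicEnergy v Ψ ≤ Literature.MathematicalPhysics.QuantumManyBody.BoseGas.periodicGroundStateEnergy v (n + 1) (Literature.MathematicalPhysics.QuantumManyBody.BoseGas.sideLength ρ (n + 1)) + δ ∧ (∀ X, Ψ.ψ X = (‖Ψ.ψ X‖ : ℂ)) ∧ ∀ x y : Literature.MathematicalPhysics.QuantumManyBody.BoseGas.Space,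 ∫⁻ Y in Literature.MathematicalPhysics.QuantumManyBody.BoseGas.cellN n (Literature.MathematicalPhysics.QuantumManyBody.BoseGas.sideLength ρ (n + 1)), (‖Ψ.ψ (Matrix.vecCons x Y)‖₊ : ENNReal) ^ 2 ≤ ENNReal.ofReal (Real.exp C) * ∫⁻ Y in Literature.MathematicalPhysics.QuantumManyBody.BoseGas.cellN n (Literature.MathematicalPhysics.QuantumManyBody.BoseGas.sideLength ρ (n + 1)), (‖Ψ.ψ (Matrix.vecCons x Y)‖₊ : ENNReal) * (‖Ψ.ψ (Matrix.vecCons y Y)‖₊ : ENNReal)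

-- item stmt-AtomisticToContinuum-9758 · support · rank 3 · open · by planner — informal only, no Lean statement yet:
--   [crux] PHONON DRESSING = bounded many-body remainder (card riesz-shadow-harmonic-extension rung R3,
--   sharpened by the positive-type principle PositiveTypeJastrowKL; informal until the
--   short-range/many-body split of −log Ψ₀² is typed — needs the zero-energy scattering solution f_v as
--   a function and a smooth radial cut-off, see the route's DEFINITION REQUESTS; same text as
--   stmt-AtomisticToContinuum-7719 of the retired BECRieszLadder). Setting: admissible BOUNDED v, 0 < ρ
--   < ρ₀(v), N = n+1 → ∞ on the torus of side L = (N/ρ)^{1/3}, Ψ₀ > 0 the (translation-invariant)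
--   periodic ground state, a = scatte

/-- item stmt-AtomisticToContinuum-9159 · support · rank 9 · open · by planner
sources: Reatto1969, Chester1970, ReattoChester1967, McMillan1965
[support] POSITIVE-TYPE PRINCIPLE (Reatto-type, elementary; the engine of the ladder). For L > 0,
any n, and u : ℝ³ → ℝ continuous, even, Lℤ³-periodic and conditionally positive-definite (Σ_i c_i =
0 ⇒ Σ_ij c_i c_j u(z_i − z_j) ≥ 0), with U(X) = Σ_(i<j) u(X_i − X_j) on (n+1)-configurations:
∫_(cell^n) e^(−U(x,Y)) (U(y,Y) − U(x,Y)) dY ≤ (u(0) − u(x−y)) ∫_(cell^n) e^(−U(x,Y)) dY for all x,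
y. Proof: translation invariance gives E_(P_x)[ΔU] = ρ[(u∗h)(r) − (u∗h)(0)] = L⁻³Σ_(k≠0) û(k)(1 −
S(k))(1 − cos k·r) with ρĥ(k) = S(k) − 1, and S(k) ≥ 0, û(k) ≥ 0, L⁻³Σ_(k≠0)û(k)cos k·r = u(r) −
û(0)L⁻³ (Bochner on the torus: absolutely convergent series). [difficulty: provable-now] -/
@[route_item "route-AtomisticToContinuum-BECRieszShadow"]
def PositiveTypeJastrowKL : Prop :=
  ∀ (n : ℕ) (L : ℝ) (u : Literature.MathematicalPhysics.QuantumManyBody.BoseGas.Space → ℝ), 0 < L → Continuous u → (∀ z : Literature.MathematicalPhysics.QuantumManyBody.BoseGas.Space, u (-z) = u z) → (∀ (z : Literature.MathematicalPhysics.QuantumManyBody.BoseGas.Space) (k : Fin 3), u (z + EuclideanSpace.single k L) = u z) → (∀ (m : ℕ) (z : Fin m → Literature.MathematicalPhysics.QuantumManyBody.BoseGas.Space) (c : Fin m → ℝ), ∑ i, c i = 0 → 0 ≤ ∑ i, ∑ j, c i * c j * u (z i - z j)) → ∀ U : Literature.MathematicalPhysics.QuantumManyBody.BoseGas.Config (n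 + 1) → ℝ, U = (fun X => ∑ i : Fin (n + 1), ∑ j : Fin (n + 1) with i < j, u (X i - X j)) → ∀ x y : Literature.MathematicalPhysics.QuantumManyBody.BoseGas.Space, ∫ Y in Literature.MathematicalPhysics.QuantumManyBody.BoseGas.cellN n L, Real.exp (-U (Matrix.vecCons x Y)) * (U (Matrix.vecCons y Y) - U (Matrix.vecCons x Y)) ≤ (u 0 - u (x - y)) * ∫ Y in Literature.MathematicalPhysics.QuantumManyBody.BoseGas.cellN n L, Real.exp (-U (Matrix.vecCons x Y))

/-- item stmt-AtomisticToContinuum-9160 · support · rank 9 · open · by planner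
sources: Lewin2022, Serfaty2024, CaffarelliSilvestre2007, PetracheSerfaty2015
[support] THE LADDER'S KERNELS. For 0 < s < 3 there is C(s) such that for all L, η > 0 the smeared
zero-mean periodic Riesz-s kernel g(x) = K_s ∫_(η²)^∞ t^((1−s)/2) (Σ_(m∈ℤ³) heatKernel t (x − Lm) −
L⁻³) dt, K_s = (4π)^(3/2) 4^(−s/2)/Γ(s/2) (heat-kernel subordination: K_s∫₀^∞ t^((1−s)/2) G_t(x) dt
= |x|^(−s); s = 1: 4π∫G_t = 1/|x|, cf. lintegral_Ioi_heatKernel), is continuous, even, Lℤ³-periodic,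
conditionally positive-definite (ĝ(k) = K_s∫_(η²)^∞ t^((1−s)/2) e^(−t|k|²) dt > 0 for k ≠ 0, ĝ(0) =
0) and has g(0) − g(z) ≤ C η^(−s) for all z, UNIFORMLY IN L (g(0) − g(z) ≤ 2g(0), 0 ≤ Θ_L(t,0) − L⁻³
≲ (4πt)^(−3/2) + O(L⁻³)·1_(t ≲ L²)). This is where the exponent acts: for s ≤ 0 the same integral
grows like log(L/η) (s = 0) or L^(|s|). [difficulty: provable-now] -/
@[route_item "route-AtomisticToContinuum-BECRieszShadow"]
def RieszKernelPositiveType : Prop :=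
  ∀ s : ℝ, 0 < s → s < 3 → ∃ C : ℝ, 0 < C ∧ ∀ (L η : ℝ), 0 < L → 0 < η → ∀ g : Literature.MathematicalPhysics.QuantumManyBody.BoseGas.Space → ℝ, g = (fun x => (4 * Real.pi) ^ (3 / 2 : ℝ) * (4 : ℝ) ^ (-(s / 2)) / Real.Gamma (s / 2) * ∫ t in Set.Ioi (η ^ 2), t ^ ((1 - s) / 2) * ((∑' m : Fin 3 → ℤ, Literature.Analysis.UnboundedOperators.heatKernel t (x - Literature.MathematicalPhysics.QuantumManyBody.BoseGas.latticeVec L m)) - 1 / L ^ 3)) → Continuous g ∧ (∀ z : Literature.MathematicalPhysics.QuantumManyBody.BoseGas.Space, g (-z) = g z) ∧ (∀ (z : Literature.MathematicalPhysics.QuantumManyBody.BoseGas.Space) (k : Fin 3), g (z + EuclideanSpace.single k L) = g z) ∧ (∀ (m : ℕ) (z : Fin m → Literature.MathematicalPhysics.QuantumManyBody.BoseGas.Space) (c : Fin m → ℝ), ∑ i, c i = 0 → 0 ≤ ∑ i, ∑ j, c i * c j * g (z i - z j)) ∧ ∀ z : Literature.MathematicalPhysics.QuantumManyBody.BoseGas.Space,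 g 0 - g z ≤ C * η ^ (-s)

/-- item stmt-AtomisticToContinuum-9161 · support · rank 9 · open · by planner
sources: Reatto1969, ReattoChester1967, McMillan1965, Chester1970, PenroseOnsager1956
[support] THE LADDER THEOREM (card rungs R1 = s=1 Bijl–Dingle–Jastrow/one-component plasma and R2 =
s=2 phonon class, now for all 0<s<3 and EVERY coupling b, smearing η, N): for the smeared Riesz-s
Jastrow state ψ = exp(−(b/2)Σ_(i<j) g(X_i−X_j)) on the torus, condensateOccupation ≥ exp(−C(s) b
η^(−s)) (n+1) ‖ψ‖²_(cell^(n+1)) — TL-BEC of an explicit correlated translation-invariant 3-D Bose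
wave function whose |ψ|² is the canonical smeared Riesz gas at inverse temperature b (any phase of
that gas, cf. Chester1970 supersolid remark). Corollary of PositiveTypeJastrowKL +
RieszKernelPositiveType + PalmJensen + the Fubini step of PalmAffinityFlatMode; at η = ξ, b =
2π^(−3/2)a^(1/2)ρ^(−1/2) the bound reads n₀/N ≥ exp(−(4/√π)√(ρa³)) = 1 − 2.26√(ρa³) vs Bogoliubov's
1 − 1.505√(ρa³). [difficulty: provable-now] -/
@[route_item "route-AtomisticToContinuum-BECRieszShadow"]
def RieszJastrowCondensate : Prop :=
  ∀ s : ℝ, 0 < s → s < 3 → ∃ C : ℝ, 0 < C ∧ ∀ (n : ℕ) (L b η : ℝ), 0 < L → 0 < b → 0 < η → ∀ g : Literature.MathematicalPhysics.QuantumManyBody.BoseGas.Space → ℝ, g = (fun x => (4 * Real.pi) ^ (3 / 2 : ℝ) * (4 : ℝ) ^ (-(s / 2)) / Real.Gamma (s / 2) * ∫ t in Set.Ioi (η ^ 2), t ^ ((1 - s) / 2) * ((∑' m : Fin 3 → ℤ, Literature.Analysis.UnboundedOperators.heatKernel t (x - Literature.MathematicalPhysics.QuantumManyBody.BoseGas.latticeVec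 L m)) - 1 / L ^ 3)) → ∀ H : Literature.MathematicalPhysics.QuantumManyBody.BoseGas.Config (n + 1) → ℝ, H = (fun X => ∑ i : Fin (n + 1), ∑ j : Fin (n + 1) with i < j, g (X i - X j)) → ENNReal.ofReal (Real.exp (-(C * b * η ^ (-s))) * (n + 1)) * ∫⁻ X in Literature.MathematicalPhysics.QuantumManyBody.BoseGas.cellN (n + 1) L, ENNReal.ofReal (Real.exp (-(b * H X))) ≤ Literature.MathematicalPhysics.QuantumManyBody.BoseGas.condensateOccupation (n + 1) L (fun X => (Real.exp (-(b / 2 * H X)) : ℂ))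

/-- item stmt-AtomisticToContinuum-9162 · support · rank 9 · open · by planner
sources: Reatto1969, McMillan1965, PenroseOnsager1956
[support] PALM–JENSEN. For a continuous strictly positive ψ on (n+1)-configurations with
x-independent slice mass Z = ∫_(cell^n) ψ(x,Y)² dY: if ∫ψ(x,Y)² log(ψ(x,Y)²/ψ(y,Y)²) dY ≤ K·Z for
all x, y then e^(−K/2) Z ≤ ∫ψ(x,Y)ψ(y,Y) dY (Jensen for exp under p_x = ψ(x,·)²/Z: E[√(p_y/p_x)] ≥
exp(−½KL(p_x‖p_y))). [difficulty: provable-now] -/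
@[route_item "route-AtomisticToContinuum-BECRieszShadow"]
def PalmJensen : Prop :=
  ∀ (n : ℕ) (L K : ℝ) (ψ : Literature.MathematicalPhysics.QuantumManyBody.BoseGas.Config (n + 1) → ℝ), 0 < L → Continuous ψ → (∀ X, 0 < ψ X) → (∀ x y : Literature.MathematicalPhysics.QuantumManyBody.BoseGas.Space, ∫ Y in Literature.MathematicalPhysics.QuantumManyBody.BoseGas.cellN n L, ψ (Matrix.vecCons x Y) ^ 2 = ∫ Y in Literature.MathematicalPhysics.QuantumManyBody.BoseGas.cellN n L, ψ (Matrix.vecCons y Y) ^ 2) → (∀ x y : Literature.MathematicalPhysics.QuantumManyBody.BoseGas.Space, ∫ Y in Literature.MathematicalPhysics.QuantumManyBody.BoseGas.cellN n L, ψ (Matrix.vecCons x Y) ^ 2 * Real.log (ψ (Matrix.vecCons x Y) ^ 2 / ψ (Matrix.vecCons y Y) ^ 2) ≤ K * ∫ Y in Literature.MathematicalPhysics.QuantumManyBody.BoseGas.cellN n L, ψ (Matrix.vecCons x Y) ^ 2) → ∀ x y : Literature.MathematicalPhysics.QuantumManyBody.BoseGas.Space, Real.exp (-(K / 2)) * ∫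 Y in Literature.MathematicalPhysics.QuantumManyBody.BoseGas.cellN n L, ψ (Matrix.vecCons x Y) ^ 2 ≤ ∫ Y in Literature.MathematicalPhysics.QuantumManyBody.BoseGas.cellN n L, ψ (Matrix.vecCons x Y) * ψ (Matrix.vecCons y Y)

/-- item stmt-AtomisticToContinuum-9163 · support · rank 9 · open · by planner
sources: PenroseOnsager1956, LSSY2005, Fournais2020
[support] AFFINITY ⇒ FLAT MODE. For L > 0 and a nonnegative periodic trial state Ψ of n+1 bosons
with ∫|Ψ(x,Y)|² dY ≤ e^C ∫|Ψ(x,Y)||Ψ(y,Y)| dY for all x, y: condensateOccupation ≥ e^(−C)(n+1) (n₀ =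
(n+1)L⁻³∫_cell∫_cell∫_(cell^n) Ψ(x,Y)Ψ(y,Y); Fubini for x::Y through the cell indicators of
condensateOccupation; ∫_cell∫_(cell^n)|Ψ(x,Y)|² = 1). [difficulty: provable-now] -/
@[route_item "route-AtomisticToContinuum-BECRieszShadow", crux]
def PalmAffinityFlatMode : Prop :=
  ∀ (n : ℕ) (L C : ℝ), 0 < L → ∀ Ψ : Literature.MathematicalPhysics.QuantumManyBody.BoseGas.PeriodicTrialState (n + 1) L, (∀ X, Ψ.ψ X = (‖Ψ.ψ X‖ : ℂ)) → (∀ x y : Literature.MathematicalPhysics.QuantumManyBody.BoseGas.Space, ∫⁻ Y in Literature.MathematicalPhysics.QuantumManyBody.BoseGas.cellN n L, (‖Ψ.ψ (Matrix.vecCons x Y)‖₊ : ENNReal) ^ 2 ≤ ENNReal.ofReal (Real.exp C) * ∫⁻ Y in Literature.MathematicalPhysics.QuantumManyBody.BoseGas.cellN n L, (‖Ψ.ψ (Matrix.vecCons x Y)‖₊ : ENNReal) * (‖Ψ.ψ (Matrix.vecCons y Y)‖₊ : ENNReal)) → ENNReal.ofReal (Real.exp (-C) * (n + 1)) ≤ Literature.MathematicalPhysics.QuantumManyBody.BoseGas.condensateOccupation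 (n + 1) L Ψ.ψ

/-- item stmt-AtomisticToContinuum-9164 · support · rank 9 · closed · proved by Summit.AtomisticToContinuum.BoseEinsteinCondensation.Theorems.periodicOccupationStability_proof (prover) · by planner
sources: LSSY2005, Fournais2020
[support] OCCUPATION STABILITY on the torus: for periodic trial states Ψ, Φ of N bosons and |c| = 1,
condensateOccupation(Ψ)^(1/2) ≤ condensateOccupation(Φ)^(1/2) + N^(1/2) (∫_(cell^N)|Ψ − cΦ|²)^(1/2)
(F_Ψ(Y) = ⟨φ₀, Ψ(·,Y)1_cell⟩, |F_Ψ − F_(cΦ)| ≤ ‖(Ψ − cΦ)(·,Y)‖_(L²(cell)), Minkowski in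
L²(cell^(N−1)); occ(cΦ) = occ(Φ)). [difficulty: provable-now] -/
@[route_item "route-AtomisticToContinuum-BECRieszShadow", crux]
def PeriodicOccupationStability : Prop :=
  ∀ (N : ℕ) (L : ℝ), 0 < L → ∀ (Ψ Φ : Literature.MathematicalPhysics.QuantumManyBody.BoseGas.PeriodicTrialState N L) (c : ℂ), ‖c‖ = 1 → Literature.MathematicalPhysics.QuantumManyBody.BoseGas.condensateOccupation N L Ψ.ψ ^ (1 / 2 : ℝ) ≤ Literature.MathematicalPhysics.QuantumManyBody.BoseGas.condensateOccupation N L Φ.ψ ^ (1 / 2 : ℝ) + (N : ENNReal) ^ (1 / 2 : ℝ) * (∫⁻ X in Literature.MathematicalPhysics.QuantumManyBody.BoseGas.cellN N L, (‖Ψ.ψ X - c * Φ.ψ X‖₊ : ENNReal) ^ 2) ^ (1 / 2 : ℝ)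

/-- `PeriodicOccupationStability` holds: proved by `Summit.AtomisticToContinuum.BoseEinsteinCondensation.Theorems.periodicOccupationStability_proof`. -/
theorem PeriodicOccupationStability_holds : PeriodicOccupationStability := _root_.Summit.AtomisticToContinuum.BoseEinsteinCondensation.Theorems.periodicOccupationStability_proof

/-- item stmt-AtomisticToContinuum-9165 · support · rank 9 · open · by planner
sources: LSSY2005, PenroseOnsager1956
[support] FRAME GLUE (pure bookkeeping once the two support inequalities are available; filed as an
item so that the deciding theorem `closes` is term-mode logic): PalmAffinityBound → PeriodicRigidity
→ PalmAffinityFlatMode → PeriodicOccupationStability → PeriodicBEC-body (verbatim the body of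
stmt-AtomisticToContinuum-0826: ∀ admissible v ∃ρ₀ ∀ρ<ρ₀ ∃c>0 ∀ᶠN ∃δ>0 ∀ δ-near-minimisers Ψ of the
periodic energy, c·N ≤ condensateOccupation). Proof: fix v; ρ₀ = min; c := e^(−C)/4; eventually in N
= n+1 (index shift n ↦ n+1 under atTop) take η := e^(−C)/4 in PeriodicRigidity to get δ; the
∃-witness Ψ of PalmAffinityBound at δ has condensateOccupation ≥ e^(−C)N by PalmAffinityFlatMode;
for any δ-near-minimiser Φ, rigidity + PeriodicOccupationStability give
condensateOccupation(Φ)^(1/2) ≥ (e^(−C)N)^(1/2) − (Nη)^(1/2) = (e^(−C)N)^(1/2)/2. ENNReal arithmetic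
only. [difficulty: provable-now] -/
@[route_item "route-AtomisticToContinuum-BECRieszShadow", crux]
def AffinityFrameGlue : Prop :=
  PalmAffinityBound → PeriodicRigidity → PalmAffinityFlatMode → PeriodicOccupationStability → ∀ v : ℝ → ENNReal, Literature.MathematicalPhysics.QuantumManyBody.BoseGas.IsRepulsiveFiniteRange v → ∃ ρ₀ : ℝ, 0 < ρ₀ ∧ ∀ ρ : ℝ, 0 < ρ → ρ < ρ₀ → ∃ c : ℝ, 0 < c ∧ ∀ᶠ N : ℕ in Filter.atTop, ∃ δ : ENNReal, 0 < δ ∧ ∀ Ψ : Literature.MathematicalPhysics.QuantumManyBody.BoseGas.PeriodicTrialState N (Literature.MathematicalPhysics.QuantumManyBody.BoseGas.sideLength ρ N), Literature.MathematicalPhysics.QuantumManyBody.BoseGas.periodicEnergy v Ψ ≤ Literature.MathematicalPhysics.QuantumManyBody.BoseGas.periodicGroundStateEnergy v N (Literature.MathematicalPhysics.QuantumManyBody.BoseGas.sideLength ρ N) + δ → ENNReal.ofReal (c * N) ≤ Literature.MathematicalPhysics.QuantumManyBody.BoseGas.condensateOccupation N (Literature.MathematicalPhysics.QuantumManyBody.BoseGas.sideLength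 ρ N) Ψ.ψ

-- earlier AffinityOfEntropy (stmt-AtomisticToContinuum-14240, replaced 2026-08-16T03:17:54Z -> stmt-AtomisticToContinuum-14376): retired by None — TeleportEntropyBound → PalmJensen → HardCorePalmAffinity → PalmAffinityBound
-- earlier AffinityOfEntropy (stmt-AtomisticToContinuum-14569, replaced 2026-08-16T03:58:36Z -> stmt-AtomisticToContinuum-14579): retired by None — TeleportEntropyBound → PalmJensen → HardCorePalmAffinity → PalmAffinityBound
/-- item stmt-AtomisticToContinuum-14579 · support · rank 10 · open · by planner
sources: Reatto1969, PenroseOnsager1956, LSSY2005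
[support] GLUE TO THE TARGET from the cruxes, by name (two-layer plan (i) of route BECRieszShadow;
answers route.target-unreachable and the 2026-08-16 gate rule that only CRUX items are hypotheses
while supports enter as proved lemmas): TeleportEntropyBound → HardCorePalmAffinity →
PalmAffinityBound, with the provable-now support PalmJensen (stmt-AtomisticToContinuum-9162, shared
with BECLiebAntibunching) used as a LEMMA inside the proof (prove stmt-9162 first; the planner's
candidate GlueProofFinal.lean proves `PalmJensen → AffinityOfEntropy` sorry-free on the farm, incl.
the Bochner→lintegral conversion, and is attached as evidence). Rank 10 is render order only
(history: stmt-14240 rank 9 rendered BLOCKED by a forward reference to PalmJensen, rev 7; stmt-14376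
inlined PalmJensen, rev 8; stmt-14569 named PalmJensen as a hypothesis, rev 10 — under the new rule
a support hypothesis does not derive the target, so PalmJensen moves inside the proof). Proof: fix
admissible v; by_cases h : ∃ M : NNReal, ∀ r, v r ≤ M. Unbounded: HardCorePalmAffinity v hv h is the
claim verbatim. Bounded: TeleportEntropyBound v hv h gives ρ₀ and, for ρ < ρ₀, C with, eventually in
n, for every δ > 0 a δ-ne -/
@[route_item "route-AtomisticToContinuum-BECRieszShadow"]
def AffinityOfEntropy : Prop :=
  TeleportEntropyBound → HardCorePalmAffinity → PalmAffinityBound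

-- earlier Assembly (stmt-AtomisticToContinuum-9166, replaced 2026-08-15T16:15:48Z -> stmt-AtomisticToContinuum-10446): retired by None — PalmAffinityBound → PeriodicRigidity → PalmAffinityFlatMode → PeriodicOccupationStability → AffinityFrameGlue → BoundaryTransferWeak → BoseEinsteinCondensation
/-- item stmt-AtomisticToContinuum-10446 · assembly · rank 1 · open · by planner
sources: LSSY2005, PenroseOnsager1956
[assembly] PalmAffinityBound → PeriodicRigidity → PalmAffinityFlatMode → PeriodicOccupationStability
→ AffinityFrameGlue → BoundaryTransferWeak → BoseEinsteinCondensation (the sub-problem Statement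
decl `_root_.BoseEinsteinCondensation`, by name) — the same type as the DECIDING THEOREM `closes`
(glue.lean, native OK at rev 4); term: `fun hA hR hF hS hG hT v hv => hT v hv ((hG hA hR hF hS) v
hv)` (AffinityFrameGlue yields the PeriodicBEC body for v, BoundaryTransferWeak v hv turns it into
∃ρ₀ ∀ρ<ρ₀ HasGroundStateBEC v ρ). Restated verbatim (up to the `_root_.` prefix) from
stmt-AtomisticToContinuum-9166, whose render was stuck on a stale `BLOCKED: missing decl
BoundaryTransferWeak` marker after the 14:10Z lost-update of 0827; candidate proofs of 9166
(Assembly9166.lean, BECRieszAssemblyCandidate.lean) apply unchanged. -/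
@[route_item "route-AtomisticToContinuum-BECRieszShadow"]
def Assembly : Prop :=
  PalmAffinityBound → PeriodicRigidity → PalmAffinityFlatMode → PeriodicOccupationStability → AffinityFrameGlue → BoundaryTransferWeak → _root_.BoseEinsteinCondensation

/-! D-0027 §2.1 — DECIDING THEOREM (planner-authored via `route open/edit --closes-file`; by planner-rchoice-AtomisticToContinuum-BECRieszS-f8808839-0 2026-08-16T03:11:24Z):
its hypotheses are this route's items and its conclusion the sub-problem Statement (glue_lint), and it elaborates with this file. -/

@[closes "route-AtomisticToContinuum-BECRieszShadow"] theorem closes (hA : PalmAffinityBound) (hR : PeriodicRigidity) (hF : PalmAffinityFlatMode) (hS : PeriodicOccupationStability) (hG : AffinityFrameGlue) (hT : BoundaryTransferWeak) : _root_.BoseEinsteinCondensation :=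
  fun v hv => hT v hv ((hG hA hR hF hS) v hv)

end Summit.AtomisticToContinuum.BoseEinsteinCondensation.Theses.BECRieszShadow
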